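import Mathlib
import Summits.KontsevichZagierPeriods.Zeta5Search.ZeroWindowClasses
import Summits.KontsevichZagierPeriods.Zeta5Search.RecordWindowsA4
import Summits.KontsevichZagierPeriods.Zeta5Search.ClassDataDecide
import Summits.KontsevichZagierPeriods.Zeta5Search.SecondResidueLaw
import Summits.KontsevichZagierPeriods.Zeta5Search.AtlasRayRecord
import Summits.KontsevichZagierPeriods.Zeta5Search.CellKitCentre
import Summits.KontsevichZagierPeriods.Zeta5Search.TSWindowO46P1
import Summits.KontsevichZagierPeriods.Zeta5Search.A4WindowM48P1
import Summits.KontsevichZagierPeriods.Zeta5Search.ShapeClauseTransfer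
import Summits.KontsevichZagierPeriods.Zeta5Search.LawA5Proof
import Summits.KontsevichZagierPeriods.Zeta5Search.FourthOrderResidue
import Summits.KontsevichZagierPeriods.Zeta5Search.RecordCellAAtlasNotMin
import Summits.KontsevichZagierPeriods.Zeta5Search.A4WindowM48
import Summits.KontsevichZagierPeriods.Zeta5Search.L5ShapeM48P1
import Summits.KontsevichZagierPeriods.Zeta5Search.L5ShapeM48P2
import Summits.KontsevichZagierPeriods.Zeta5Search.L5ShapeM48P3
import Summits.KontsevichZagierPeriods.Zeta5Search.L5ShapeM48P4
import Summits.KontsevichZagierPeriods.Zeta5Search.L5ShapeM48P5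
import Summits.KontsevichZagierPeriods.Zeta5Search.L5ShapeM48P6
import Summits.KontsevichZagierPeriods.Zeta5Search.L5ShapeM48P7
import Summits.KontsevichZagierPeriods.Zeta5Search.L5ShapeM48P8
import HarnessLib

/-!
# ζ(5) search — L5 SHAPE window `M = 48` of `SecondResidueLaw.lean`: `RecShapesM48` (part 9/9) (HONEST FRAMING: systematic search; no irrationality claim unless certified)

Cell `pub-zeta5`,
    prover seat p3 generation 3.  MACHINE-GENERATED by `code/gen/shapegen.py` (p3 g3): the shape clause (T4) of gen-2 g13's second residue law
for the record ray `bRec n = bLin (11n) (7n) n` on the window `10 * n < 9 * p`,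
    `8 * p ≤ 9 * n` — per class: exponent `−45` ⇒ the type list is a degree-3
T-shape of `T48` (certified by explicit raise chains through gen-2 g15's `ClassDecide.isRaiseN_succ_of_*`),
    or the class is the odd-centre class with a
degree-2 T-shape.  The bracket classification is NOT redone: the decision trees call the landed leaf theorems `A4WindowM48.leaf_L*` of the LawA4
window (this window is a sub-window).  Target: `SecondResidueLaw.RecShapesM48` and the window bound `RecWindowL5M48` (-88, unconditional via
`SecondOrder.lawA5_holds`, `SecondOrder.recFrameL5_of_unshifted`,
    `A4WindowM48.recClassesM48_holds`).  Integer bookkeeping; nothing here bears on irrationality.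
-/

open Finset

namespace Summit.KontsevichZagierPeriods.Zeta5Search.L5ShapeM48

open Summit.KontsevichZagierPeriods.Zeta5Search.ClusterValuation (netExp classSet CentreIn classExp conjClass bRec classPoleCount)
open Summit.KontsevichZagierPeriods.Zeta5Search.CasoratianValuation (InPolytope shift casoratian)
open Summit.KontsevichZagierPeriods.Zeta5Search.CellKit
open Summit.KontsevichZagierPeriods.Zeta5Search.SecondOrder (classTypeList isRaise isRaise2 classTypeList_level raiseAtList lawA5_holds recFrameL5_of_unshifted)
open Summit.KontsevichZagierPeriods.Zeta5Search.SecondResidueLaw (isRaiseN ShapeClause RecShapesM48 RecWindowL5M48 recWindowL5M48_of)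
open Summit.KontsevichZagierPeriods.Zeta5Search.AtlasRayRecord
open Summit.KontsevichZagierPeriods.Zeta5Search.RecordWindowsA4


/-- **Shape clause (T4) on the window** `10 * n < 9 * p`, `8 * p ≤ 9 * n`: `ShapeClause (bRec n) p 48 T48` (every pole class with `ν = −45`;
single-pole classes have `ν ≥ −6`, multipole classes `ν = E`, and the per-class theorems `sh_L*` give the T-shapes). -/
theorem shapeClause (n p : ℕ) (hprime : p.Prime) (h1 : 10 * n < 9 * p) (h2 : 8 * p ≤ 9 * n) : ShapeClause (bRec n) p 48 T48 := by
  haveI : Fact p.Prime := ⟨hprime⟩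
  have hp2 : p % 2 = 1 := by
    rcases hprime.eq_two_or_odd with rfl | h
    · omega
    · exact h
  have key : ∀ x, x < p → classExp (bRec n) p x = -45 →
      isRaiseN 3 T48 (classTypeList (bRec n) p x) = true ∨
      (¬ (2 : ℤ) ∣ (bRec n) 0 ∧ CentreIn (bRec n) p x ∧ isRaiseN 2 T48 (classTypeList (bRec n) p x) = true) := by
    intro x hx
    rw [bRec_eq_bLin]
    rcases Nat.lt_or_ge (41 * n) (x + 37 * p) with hL37 | hL37
    · rcases Nat.lt_or_ge (41 * n) (x + 36 * p) with hL36 | hL36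
      · exact sh_L35 h1 h2 hp2 hx (by omega) (by omega)
      · exact sh_L36 h1 h2 hp2 hx (by omega) (by omega)
    · exact sh_L37 h1 h2 hp2 hx (by omega) (by omega)
  unfold ShapeClause
  intro z hz hpc hnz
  by_cases h1p : classPoleCount (bRec n) p z ≤ 1
  · have h6 := ResidueFour.neg_six_le_classExp_of_classPoleCount_le_one (bRec n) p z h1p
    have h7 := CellA.classExp_le_classNu (bRec n) p z
    omega
  · have hcl : ClusterValuation.classNu (bRec n) p z = classExp (bRec n) p z := by
      unfold ClusterValuation.classNu
      rw [if_neg (fun h => absurd h.1 (by omega))]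
    exact key z hz (by omega)

/-- **`SecondResidueLaw.RecShapesM48` IS A THEOREM**: the L5 frame `RecFrameL5 n p 48 T48` at every prime of the window `10 * n < 9 * p`,
    `8 * p ≤ 9 * n`
(`LawA4Classes` from the landed `A4WindowM48.recClassesM48_holds` on the wider LawA4 window, the shape clause above, and typer g13's transfer
`SecondOrder.recFrameL5_of_unshifted` to `b + e₇`). -/
theorem recShapesM48_holds : RecShapesM48 := by
  intro n p hn hprime h1 h2 hsq
  exact recFrameL5_of_unshifted (by omega) hprime (by omega) (by norm_num)
    (A4WindowM48.recClassesM48_holds n p hn hprime (by omega) (h2) hsq) (shapeClause n p hprime h1 h2)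
/-- **`SecondResidueLaw.RecWindowL5M48` IS A THEOREM**: `v_p(Cas₇(b(n))) ≥ -88` (`= 8 − 2·48 = casLB + 5`, the Brown–Zudilin value) at every prime of
the record window `10 * n < 9 * p`,
    `8 * p ≤ 9 * n` with `41n + 2 < p²` — UNCONDITIONAL: typer g13's `SecondOrder.lawA5_holds` (THEOREM L5) + gen-2 g13's
reduction `recWindowL5M48_of` + `recShapesM48_holds`. -/
theorem recWindowL5M48_holds : RecWindowL5M48 := recWindowL5M48_of lawA5_holds recShapesM48_holds

end Summit.KontsevichZagierPeriods.Zeta5Search.L5ShapeM48
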